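/-
Speedrun cell sr-mbsolver — LIT team (lit-1 gen-8), LEAD D-19 r118 (c) default track: lane-B transport for
`relax = mps(N, D, A)` rows ("THEOREM B" of `sr-mbsolver-lit-4/THEOREM-B.md`), PRIMAL form — the MODEL-INDEPENDENT core.
HONEST FRAMING: first certified bounds; not a superconductivity verdict; every number certified or labelled float.

WHAT THIS GIVES. `exists_mpsRows_of_window`: for ANY local dimension `q`, any real charge-covariant MPS tensor `A` (site charges
`qs : Fin q → G`, bond charges `qb : β → G` in an additive group, `A^s_{ab} ≠ 0 ⇒ qb b = qb a + qs s`), any a-priori bounds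
`B_m ≥ 0` with `‖T^{m−2}‖_F² ≤ B_m²`, and any `N = m'+2 ≥ 4`-site window variable `ρ` that is PSD with trace one, locally
translation invariant (`tr_L ρ = tr_R ρ`), block diagonal in the total charge `Σ_x qs(·_x)` and entrywise real, THERE IS a family
`ω = (ω_m)_{4 ≤ m ≤ N}` (namely KSDN's `ω_m = C_{m−2}(ρ|_{first m})`) satisfying every `ω`-row of the `relax = mps(N, D, A)` problem
of `FORMAT-ltisdp.md` §1/§4.7 relative to the head marginal `ρ₃ = ρ|_{first 3}`: E4L `tr_{s_L} ω₄ = (W₂ ⊗ 𝟙) ρ₃ (W₂ ⊗ 𝟙)ᴴ`,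
E4R `tr_{s_R} ω₄ = (𝟙 ⊗ W₂) ρ₃ (𝟙 ⊗ W₂)ᴴ`, E_mL `tr_{s_L} ω_m = (L ⊗ 𝟙) ω_{m−1} (L ⊗ 𝟙)ᴴ`, E_mR `tr_{s_R} ω_m = (𝟙 ⊗ R) ω_{m−1} (𝟙 ⊗ R)ᴴ`
(`m = k+5 ≤ N`), `ω_m ⪰ 0`, the sector zeros for the tags `qs(s_L) + (qb b − qb a) + qs(s_R)` (`cgTag`), real entries, and
`|ω_m| ≤ B_m` (`m = k+4 ≤ N`) — with `W₂ = cgMap A 2`, `L = leftMap A`, `R = rightMap A` of `Literature/…/MPSCoarseGrainingMaps`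
(KSDN's maps in the generator's index conventions). This is the common core of the spin transport
(`Transport/MPSPrimalSpinChain.lean`, where it is inlined) and of the fermion (Jordan–Wigner `q = 4`) transport
(`Transport/MPSPrimalHubbardChain.lean`). No model, no objective and no density row enter here.

PROOF = KSDN arXiv:2212.03014 §4.2 ("these satisfy (arrowDiagram) due to (MPSextension) and the conditions `ρ_{1..m} = ρ_{2..m+1}`"),
assembled from the gen-7 Literature files: `lti_headMarginal` / `spinPartialTrace_{succEmb,castSuccEmb}_headMarginal`
(MPSNestedMarginals), `traceLeft_cgState` / `traceRight_cgState_submatrix_prodAssoc` / `traceLeft_cgState_headMarginal` /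
`traceRight_cgState_headMarginal` (MPSCoarseGrainingMaps, MPSNestedMarginals), `posSemidef_cgState`,
`norm_cgState_apply_le_of_transferOp` (MPSTransferMatrix), `cgState_apply_eq_zero_of_cgTag_ne` (MPSCoarseGrainingSectors),
`star_cgState_apply` / `star_headMarginal_apply` (MPSCoarseGrainingReal), and the inheritance of charge sectors by marginals
(`headMarginal_apply_eq_zero_of_charge` of `Transport/MPSPrimalSpinChain.lean`). [cite: KullEtAl2024, §2.3–2.5 eqs. (TNoneStepRelaxation), (TNfullRelax5); §4.2 eqs. (MPSextension), (relaxLocTIn)]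
-/
import Summits.Ventures.CertifiedManyBodySolver.Transport.MPSPrimalSpinChain
import HarnessLib

noncomputable section

open Matrix Complex
open scoped ComplexOrder Kronecker BigOperators
open Literature.MathematicalPhysics.QuantumLattice
open Literature.MathematicalPhysics.QuantumLattice.MPSCoarseGraining
open Literature.Computability.QuantumComplexity (traceLeft traceRight)

namespace Summit.Ventures.CertifiedManyBodySolver.Transport

/-! ### The `ω`-rows of `relax = mps(N, D, A)` hold at KSDN's point `ω_m = C_{m−2}(ρ|_{first m})` -/

section Window

variable {β G : Type*} [Fintype β] [DecidableEq β] [AddCommGroup G] {q : ℕ}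

/-- **KSDN's feasible point, model-independent core** (`N = m'+2 ≥ 4` sites). Given a real, charge-covariant MPS tensor `A`
with a-priori bounds `B_m` (`0 ≤ B_m`, `‖T^{m−2}‖_F² ≤ B_m²`) and a window variable `ρ ⪰ 0`, `tr ρ = 1`, `tr_L ρ = tr_R ρ`,
block diagonal in the total charge `Σ_x qs(·_x)`, entrywise real — there is a family `ω` such that, with `ρ₃ := ρ|_{first 3}`
(`headMarginal`): E4L, E4R, E_mL / E_mR (`m = k+5 ≤ N`), `ω_m ⪰ 0`, `cgTag qs qb` sector zeros, real entries and `|ω_m| ≤ B_m`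
(`m = k+4 ≤ N`) — the `ω`-rows of FORMAT-ltisdp §1/§4.7 with `W₂ = cgMap A 2`, `L = leftMap A`, `R = rightMap A`.
The witness is `ω_m = C_{m−2}(ρ|_{first m})` (`cgState`). [cite: KullEtAl2024, §2.3–2.5, §4.2 eqs. (MPSextension), (relaxLocTIn)] -/
theorem exists_mpsRows_of_window (m' : ℕ) (hm' : 2 ≤ m') (A : Fin q → Matrix β β ℂ)
    (hAreal : ∀ s a b, star (A s a b) = A s a b) (qs : Fin q → G) (qb : β → G)
    (hAcov : ∀ s a b, A s a b ≠ 0 → qb b = qb a + qs s)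
    (B : ℕ → ℝ) (hB : ∀ k, k + 4 ≤ m' + 2 → 0 ≤ B (k + 4) ∧ frobSq (transferOp A ^ (k + 2)) ≤ B (k + 4) ^ 2)
    (ρ : Op (Fin (m' + 2)) q) (hpsd : ρ.PosSemidef) (htr : ρ.trace = 1)
    (hLTI : spinPartialTrace (Fin.succEmb (m' + 1)) ρ = spinPartialTrace Fin.castSuccEmb ρ)
    (hsec : ∀ u v : TensorIndex (Fin (m' + 2)) q, (∑ x, qs (u x)) ≠ (∑ x, qs (v x)) → ρ u v = 0)
    (hstar : ∀ u v : TensorIndex (Fin (m' + 2)) q, star (ρ u v) = ρ u v) :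
    ∃ ω : ℕ → Matrix (Fin q × ((β × β) × Fin q)) (Fin q × ((β × β) × Fin q)) ℂ,
      traceLeft (ω 4) = (cgMap A 2 ⊗ₖ (1 : Matrix (Fin q) (Fin q) ℂ)) *
          (headMarginal (show 3 ≤ m' + 2 by omega) ρ).submatrix
            ((Equiv.prodComm _ _).trans (Fin.snocEquiv fun _ => Fin q))
            ((Equiv.prodComm _ _).trans (Fin.snocEquiv fun _ => Fin q)) *
        (cgMap A 2 ⊗ₖ (1 : Matrix (Fin q) (Fin q) ℂ))ᴴ ∧
      traceRight ((ω 4).submatrix (Equiv.prodAssoc _ _ _) (Equiv.prodAssoc _ _ _)) =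
        ((1 : Matrix (Fin q) (Fin q) ℂ) ⊗ₖ cgMap A 2) *
          (headMarginal (show 3 ≤ m' + 2 by omega) ρ).submatrix (Fin.consEquiv fun _ => Fin q)
            (Fin.consEquiv fun _ => Fin q) *
        ((1 : Matrix (Fin q) (Fin q) ℂ) ⊗ₖ cgMap A 2)ᴴ ∧
      (∀ k, k + 5 ≤ m' + 2 → traceLeft (ω (k + 5)) =
        (leftMap A ⊗ₖ (1 : Matrix (Fin q) (Fin q) ℂ)) *
          (ω (k + 4)).submatrix (Equiv.prodAssoc _ _ _) (Equiv.prodAssoc _ _ _) *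
        (leftMap A ⊗ₖ (1 : Matrix (Fin q) (Fin q) ℂ))ᴴ) ∧
      (∀ k, k + 5 ≤ m' + 2 → traceRight ((ω (k + 5)).submatrix (Equiv.prodAssoc _ _ _) (Equiv.prodAssoc _ _ _)) =
        ((1 : Matrix (Fin q) (Fin q) ℂ) ⊗ₖ rightMap A) * ω (k + 4) *
        ((1 : Matrix (Fin q) (Fin q) ℂ) ⊗ₖ rightMap A)ᴴ) ∧
      (∀ k, k + 4 ≤ m' + 2 → (ω (k + 4)).PosSemidef) ∧
      (∀ k, k + 4 ≤ m' + 2 → ∀ i j, cgTag qs qb i ≠ cgTag qs qb j → ω (k + 4) i j = 0) ∧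
      (∀ k, k + 4 ≤ m' + 2 → ∀ i j, starRingEnd ℂ (ω (k + 4) i j) = ω (k + 4) i j) ∧
      (∀ k, k + 4 ≤ m' + 2 → ∀ i j, ‖ω (k + 4) i j‖ ≤ B (k + 4)) := by
  classical
  have h3 : 3 ≤ m' + 2 := by omega
  have h4 : 4 ≤ m' + 2 := by omega
  -- head marginals: states, real, sectored
  have hHpsd : ∀ {m} (h : m ≤ m' + 2), (headMarginal h ρ).PosSemidef := fun h => posSemidef_headMarginal h hpsd
  have hHtr : ∀ {m} (h : m ≤ m' + 2), (headMarginal h ρ).trace = 1 := fun h => by rw [trace_headMarginal, htr]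
  have hHstar : ∀ {m} (h : m ≤ m' + 2) (t s : TensorIndex (Fin m) q),
      star (headMarginal h ρ t s) = headMarginal h ρ t s := fun h t s => star_headMarginal_apply hstar h t s
  have hHsec : ∀ {m} (h : m ≤ m' + 2) (u v : TensorIndex (Fin m) q),
      (∑ x, qs (u x)) ≠ (∑ x, qs (v x)) → headMarginal h ρ u v = 0 := fun h u v huv =>
    headMarginal_apply_eq_zero_of_charge qs h hsec huv
  -- the witness `ω_m = C_{m-2}(ρ|_m)` for `4 ≤ m ≤ m'+2`, zero elsewhere
  set ω : ℕ → Matrix (Fin q × ((β × β) × Fin q)) (Fin q × ((β × β) × Fin q)) ℂ :=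
    fun m => if h : 4 ≤ m ∧ m ≤ m' + 2 then
      cgState A (m - 4 + 2) (headMarginal (show m - 4 + 2 + 2 ≤ m' + 2 by omega) ρ) else 0 with hωdef
  have hω4' : ω 4 = cgState A 2 (headMarginal h4 ρ) :=
    dif_pos (show 4 ≤ 4 ∧ 4 ≤ m' + 2 from ⟨le_rfl, h4⟩)
  have hω4 : ∀ k (hk : k + 4 ≤ m' + 2), ω (k + 4) = cgState A (k + 2) (headMarginal hk ρ) := fun k hk =>
    dif_pos (show 4 ≤ k + 4 ∧ k + 4 ≤ m' + 2 from ⟨by omega, hk⟩)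
  have hω5 : ∀ k (hk : k + 5 ≤ m' + 2), ω (k + 5) = cgState A (k + 3) (headMarginal hk ρ) := fun k hk =>
    dif_pos (show 4 ≤ k + 5 ∧ k + 5 ≤ m' + 2 from ⟨by omega, hk⟩)
  refine ⟨ω, ?_, ?_, ?_, ?_, ?_, ?_, ?_, ?_⟩
  · -- E4L: `tr_L ρ₄ = ρ₃` by LTI
    have e2 : spinPartialTrace (Fin.succEmb 3) (headMarginal h4 ρ) = headMarginal h3 ρ :=
      spinPartialTrace_succEmb_headMarginal hLTI (show 3 ≤ m' + 1 by omega)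
    calc traceLeft (ω 4) = traceLeft (cgState A 2 (headMarginal h4 ρ)) := by rw [hω4']
      _ = (cgMap A 2 ⊗ₖ (1 : Matrix (Fin q) (Fin q) ℂ)) *
            (spinPartialTrace (Fin.succEmb 3) (headMarginal h4 ρ)).submatrix
              ((Equiv.prodComm _ _).trans (Fin.snocEquiv fun _ => Fin q))
              ((Equiv.prodComm _ _).trans (Fin.snocEquiv fun _ => Fin q)) *
          (cgMap A 2 ⊗ₖ (1 : Matrix (Fin q) (Fin q) ℂ))ᴴ := traceLeft_cgState A 2 _
      _ = _ := by rw [e2]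
  · -- E4R: `tr_R ρ₄ = ρ₃`
    have e2 : spinPartialTrace Fin.castSuccEmb (headMarginal h4 ρ) = headMarginal h3 ρ :=
      spinPartialTrace_castSuccEmb_headMarginal h4 ρ
    calc traceRight ((ω 4).submatrix (Equiv.prodAssoc _ _ _) (Equiv.prodAssoc _ _ _))
        = traceRight ((cgState A 2 (headMarginal h4 ρ)).submatrix (Equiv.prodAssoc _ _ _) (Equiv.prodAssoc _ _ _)) := by
          rw [hω4']
      _ = ((1 : Matrix (Fin q) (Fin q) ℂ) ⊗ₖ cgMap A 2) *
            (spinPartialTrace Fin.castSuccEmb (headMarginal h4 ρ)).submatrix (Fin.consEquiv fun _ => Fin q)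
              (Fin.consEquiv fun _ => Fin q) *
          ((1 : Matrix (Fin q) (Fin q) ℂ) ⊗ₖ cgMap A 2)ᴴ := traceRight_cgState_submatrix_prodAssoc A 2 _
      _ = _ := by rw [e2]
  · -- E_mL
    intro k hk5
    have hk4 : k + 4 ≤ m' + 2 := by omega
    have hkM : k + 2 + 2 ≤ m' + 1 := by omega
    rw [hω5 k hk5, hω4 k hk4]
    exact traceLeft_cgState_headMarginal A (k + 2) hLTI hkM
  · -- E_mR
    intro k hk5
    have hk4 : k + 4 ≤ m' + 2 := by omega
    have hkM : k + 2 + 2 ≤ m' + 1 := by omega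
    rw [hω5 k hk5, hω4 k hk4]
    exact traceRight_cgState_headMarginal A (k + 2) ρ hkM
  · -- PSD
    intro k hk
    rw [hω4 k hk]
    exact posSemidef_cgState A (k + 2) (hHpsd hk)
  · -- sectors
    intro k hk i j hij
    rw [hω4 k hk]
    exact cgState_apply_eq_zero_of_cgTag_ne (qs := qs) hAcov (k + 2) (hHsec hk) i j hij
  · -- real entries
    intro k hk i j
    rw [hω4 k hk, starRingEnd_apply]
    exact star_cgState_apply hAreal (k + 2) (hHstar hk) i j
  · -- a-priori bounds
    intro k hk i j
    rw [hω4 k hk]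
    exact norm_cgState_apply_le_of_transferOp A (k + 2) (hHpsd hk) (hHtr hk) (hB k hk).1 (hB k hk).2 i j

end Window

end Summit.Ventures.CertifiedManyBodySolver.Transport
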